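import Summits.BirchSwinnertonDyer.BirchSwinnertonDyer.Theorems.SignedLowerHalvesKobayashiLowerHalfLargeImageMazurTateShape
import HarnessLib

/-!
# Route `SignedLowerHalves`, crux `KobayashiLowerHalfLargeImage` (item stmt-BirchSwinnertonDyer-19001): the
# Mazur–Tate record shapes SPECIALISED TO THE TWO CERTIFIED LAYERS — `λ(θ₁) = 1` (odd colour, `ε = −1`) and
# `λ(θ₂) = p` (even colour, `ε = 1`) — with minimality as an instance hypothesis
# (cell `bsd-ssimc`, seat `bsd-ssimc-k3-c3` gen 5; a `--supports … --as helper` file; closes nothing about the crux)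

PARTITION (cell bsd-ssimc): X7 (A7) × the 306 `r_an = 1 ∧ surj(p) ∧ a_p = 0` window cells with a two-engine TIGHT
Mazur–Tate row (290 rows at layer `n = 1`, odd colour, `λ(θ₁) = deg ω₁⁺ + 1 = 1`; 16 rows at layer `n = 2`, even
colour, `λ(θ₂) = deg ω₂⁻ + 1 = p`) — closes PER PAIR only (through the records); types the object of item 3's
rank-one window at the crux's own level; crux 3
(`Summit.BirchSwinnertonDyer.BirchSwinnertonDyer.Theses.SignedLowerHalves.KobayashiLowerHalfLargeImage`) stays OPEN.
HONEST FRAMING: BSD is not proved by any of this; THEOREMS ONLY; PER PAIR, never a class theorem; nothing booked.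

## What this file does

`…MazurTateShape.lean` (p447529) states the certificate as the road does: `λ(Θ) = deg ω_n^± + 1`. The tree's rows
print `λ(θ_n)` as a NUMBER (`lamThetaB`): `1` at layer `1` (odd colour: `ω₁⁺ = 1`, the empty product) and `p` at
layer `2` (even colour: `ω₂⁻ = Φ_p(1+T)`, degree `p − 1`). This file proves the two degree identities
(`RankOne.natDegree_cyclotomicOmegaPlus_one`, `RankOne.natDegree_cyclotomicOmegaMinus_two_add_one`; Pollack 2003
§6.5) and restates the three conclusions (Kobayashi's ± main conjecture AT THE PAIR, the crux's conclusion
`∃ ε, KobayashiLowerDivisibility W p ε` AT THE PAIR, `BSDp W p` through BKO 2024 Cor. A.5) with the numeric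
certificate `λ(Θ) = 1` (layer one) / `λ(Θ) = p` (layer two), global minimality entering as the INSTANCE
hypothesis a record discharges in the kernel by the bounded Kraus/Silverman criterion of its choice
(`isGloballyMinimal_of_krausCriterion_bounded` / `…₃_bounded`), exactly as the `bsdp_x7r1_*` records do.

References: [Pollack2003] §6.5, Def. 6.15, Prop. 6.9, 6.10, 6.18; [Kobayashi2003] Thm. 1.2, Thm. 4.1, Thm. 7.4,
Conjecture (p. 2); [BurungaleKobayashiOta2023] App. A Cor. A.5; [Wuthrich2014] Lemma 20; [SilvermanAEC2009] VII.5
Prop. 5.1; [Miller2011LMS] Def. 1.1.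
-/

set_option autoImplicit false
set_option linter.dupNamespace false

noncomputable section

open scoped Classical MatrixGroups ModularForm

open Polynomial CongruenceSubgroup WeierstrassCurve Literature.NumberTheory.EllipticCurves
  Literature.NumberTheory.EllipticCurves.ModularForms
  Literature.NumberTheory.EllipticCurves.Rank1Residual
  Literature.NumberTheory.EllipticCurves.Rank1Residual.Typed
  Literature.NumberTheory.EllipticCurves.Rank1Residual.X11RankOneCertificates
  Literature.NumberTheory.EllipticCurves.Kobayashi2003
  Literature.NumberTheory.EllipticCurves.BurungaleKobayashiOta2024 ZpExtension
  Summit.BirchSwinnertonDyer.Rank1Residual.X1.MuLambda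
  Summit.BirchSwinnertonDyer.BirchSwinnertonDyer.Rank1Residual.IntModel
  Summit.BirchSwinnertonDyer.BirchSwinnertonDyer.Rank1Residual.X11RankOne
  Summit.BirchSwinnertonDyer.Rank1Residual.X11b
  Summit.BirchSwinnertonDyer.Rank1Residual.Supersingular

namespace Summit.BirchSwinnertonDyer.BirchSwinnertonDyer.Theorems

/-! ### The two degree identities -/

/-- `deg ω₁⁺ = 0`: `ω₁⁺ = ∏_{1 ≤ k ≤ 0} Φ_{p^{2k}}(1+T) = 1` (empty product). [cite: Pollack2003, §6.5 (display before Prop. 6.18)] -/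
theorem RankOne.natDegree_cyclotomicOmegaPlus_one (p : ℕ) [Fact p.Prime] :
    (cyclotomicOmegaPlus p 1).natDegree = 0 := by
  simp [cyclotomicOmegaPlus]

/-- `deg ω₂⁻ + 1 = p`: `ω₂⁻ = Φ_p(1+T)` of degree `φ(p) = p − 1`. [cite: Pollack2003, §6.5 (display before Prop. 6.18)] -/
theorem RankOne.natDegree_cyclotomicOmegaMinus_two_add_one (p : ℕ) [hp : Fact p.Prime] :
    (cyclotomicOmegaMinus p 2).natDegree + 1 = p := by
  have h1 : cyclotomicOmegaMinus p 2 = (cyclotomic p ℤ).comp (X + 1) := by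
    simp [cyclotomicOmegaMinus]
  have h2 : ((X : ℤ[X]) + 1).natDegree = 1 := by
    rw [← C_1, natDegree_X_add_C]
  rw [h1, natDegree_comp, natDegree_cyclotomic, h2, mul_one, Nat.totient_prime hp.out]
  have := hp.out.one_lt
  omega

/-! ### `BSDp` shapes with minimality as an instance hypothesis -/

/-- **RECORD SHAPE — class X7, `BSD(E,p)` AT A RANK-ONE PAIR, odd layer, minimality as the instance hypothesis**
(a record supplies it in the kernel, e.g. by `isGloballyMinimal_of_krausCriterion_bounded` / `…₃_bounded`);
otherwise word for word `X7RankOne.bsdp_of_mazurTate_odd_of_corA5_of_countPoints` (p447529): `p ∤ Δ`,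
`#Ẽ(𝔽_p) = p + 1`, an additive prime `q ∣ (Δ, c₄)`, PUBLISHED inputs `h12`/`h41`/`h5`/`h3`/`hL20`/`hGZK`/`hmod` and
BKO 2024 Cor. A.5 `hA5` (referee flags `BKO24-CorA5-IMC-unpinned`, `BKO24-CorA5-proof-by-reference-Kob14`), data
binders `hsurj`, `hr`, `hf₀`, and the certificate. Per pair; nothing booked. [cite: BurungaleKobayashiOta2023, App. A Cor. A.5]
[cite: Kobayashi2003, Thm. 7.4, Thm. 1.2, Thm. 4.1 and Conjecture (p. 2)] [cite: Pollack2003, Def. 6.15, Prop. 6.9, 6.10 and 6.18]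
[cite: Wuthrich2014, Lemma 20 (p. 399)] [cite: SilvermanAEC2009, VII.5 Prop. 5.1(a) and (c)] [cite: Miller2011LMS, §1 and Def. 1.1] -/
theorem X7RankOne.bsdp_of_mazurTate_odd_of_corA5_of_isGloballyMinimal_of_countPoints (p : ℕ) [Fact p.Prime]
    (h12 : Kobayashi2003.thm12_signedSelmerDual_finite_torsion)
    (h41 : Kobayashi2003.thm41_signedCharIdeal_divisibility)
    (h5 : realPeriodRat_eq_unit_mul_plusPeriod) (h3 : realPeriodRat_eq_unit_mul_plusPeriod_three)
    (hL20 : Wuthrich2014.lemma20_surjective_threeAdic_of_semistable)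
    (hGZK : rank_eq_analyticRank_of_analyticRank_le_one) (hmod : hasEntireLFunction_rat)
    (hA5 : corA5_pPart_of_signedCharIdeal_eq)
    (a1 a2 a3 a4 a6 : ℤ) [(⟨a1, a2, a3, a4, a6⟩ : WeierstrassCurve ℚ).IsElliptic]
    [(⟨a1, a2, a3, a4, a6⟩ : WeierstrassCurve ℚ).IsGloballyMinimal] (hp2 : p ≠ 2)
    (hpΔ : ¬ (p : ℤ) ∣ discOf [a1, a2, a3, a4, a6]) (hc : countPoints [a1, a2, a3, a4, a6] p = (p + 1 : ℕ))
    (q : ℕ) (hq : q.Prime) (hqΔ : (q : ℤ) ∣ discOf [a1, a2, a3, a4, a6])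
    (hqc₄ : (q : ℤ) ∣ c4Of [a1, a2, a3, a4, a6])
    (hsurj : Surj (⟨a1, a2, a3, a4, a6⟩ : WeierstrassCurve ℚ) p)
    (hr : (⟨a1, a2, a3, a4, a6⟩ : WeierstrassCurve ℚ).analyticRank = 1)
    [NeZero ((⟨a1, a2, a3, a4, a6⟩ : WeierstrassCurve ℚ).conductorNorm ℤ)]
    {f₀ : CuspForm (Gamma0 ((⟨a1, a2, a3, a4, a6⟩ : WeierstrassCurve ℚ).conductorNorm ℤ)) 2}
    (hf₀ : IsNewformOf (⟨a1, a2, a3, a4, a6⟩ : WeierstrassCurve ℚ) f₀)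
    {n : ℕ} (hn : Odd n) {Θ : IwasawaAlgebra p}
    (hΘ : iwasawaToPowerSeries p Θ =
      ((mazurTateElement f₀ p n).map (algebraMap ℚ ℚ_[p]) : PowerSeries ℚ_[p]))
    (hΘ0 : Θ ≠ 0) (hμ : mu Θ = 0) (hlam : lam Θ = (cyclotomicOmegaPlus p n).natDegree + 1) :
    BSDp (⟨a1, a2, a3, a4, a6⟩ : WeierstrassCurve ℚ) p := by
  have hI : integralModelInt (⟨a1, a2, a3, a4, a6⟩ : WeierstrassCurve ℚ) = ⟨a1, a2, a3, a4, a6⟩ :=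
    integralModelInt_eq_of_map_eq _ (map_mk_int a1 a2 a3 a4 a6)
  have hn' := natCard_point_eq_of_countPoints a1 a2 a3 a4 a6 p hp2 hpΔ hc
  have hX : ClassX7 (⟨a1, a2, a3, a4, a6⟩ : WeierstrassCurve ℚ) p :=
    classX7_of_intModel p hI (by rw [intCurve_Δ]; exact hpΔ) hn' (by push_cast; simp) q hq
      (by rw [intCurve_Δ]; exact hqΔ) (by rw [intCurve_c₄]; exact hqc₄)
  have hap : (⟨a1, a2, a3, a4, a6⟩ : WeierstrassCurve ℚ).frobeniusTrace p = 0 := by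
    rw [frobeniusTrace_eq hI hn']; push_cast; ring
  exact X7.bsdp_of_mazurTate_odd_of_corA5_of_analyticRank_eq_one _ p h12 h41 h5 h3 hL20 hGZK hmod hA5 hp2 hX hap
    hsurj hr hf₀ hn hΘ hΘ0 hμ hlam (lam_lt_of_mazurTate hΘ hΘ0 hμ)

/-- **RECORD SHAPE — class X7, `BSD(E,p)` AT A RANK-ONE PAIR, even layer, minimality as the instance
hypothesis**; otherwise as `X7RankOne.bsdp_of_mazurTate_even_of_corA5_of_countPoints` (p447529). Per pair;
nothing booked. [cite: BurungaleKobayashiOta2023, App. A Cor. A.5] [cite: Kobayashi2003, Thm. 7.4, Thm. 1.2, Thm. 4.1 and Conjecture (p. 2)]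
[cite: Pollack2003, Def. 6.15, Prop. 6.9, 6.10 and 6.18] [cite: Wuthrich2014, Lemma 20 (p. 399)]
[cite: SilvermanAEC2009, VII.5 Prop. 5.1(a) and (c)] [cite: Miller2011LMS, §1 and Def. 1.1] -/
theorem X7RankOne.bsdp_of_mazurTate_even_of_corA5_of_isGloballyMinimal_of_countPoints (p : ℕ) [Fact p.Prime]
    (h12 : Kobayashi2003.thm12_signedSelmerDual_finite_torsion)
    (h41 : Kobayashi2003.thm41_signedCharIdeal_divisibility)
    (h5 : realPeriodRat_eq_unit_mul_plusPeriod) (h3 : realPeriodRat_eq_unit_mul_plusPeriod_three)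
    (hL20 : Wuthrich2014.lemma20_surjective_threeAdic_of_semistable)
    (hGZK : rank_eq_analyticRank_of_analyticRank_le_one) (hmod : hasEntireLFunction_rat)
    (hA5 : corA5_pPart_of_signedCharIdeal_eq)
    (a1 a2 a3 a4 a6 : ℤ) [(⟨a1, a2, a3, a4, a6⟩ : WeierstrassCurve ℚ).IsElliptic]
    [(⟨a1, a2, a3, a4, a6⟩ : WeierstrassCurve ℚ).IsGloballyMinimal] (hp2 : p ≠ 2)
    (hpΔ : ¬ (p : ℤ) ∣ discOf [a1, a2, a3, a4, a6]) (hc : countPoints [a1, a2, a3, a4, a6] p = (p + 1 : ℕ))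
    (q : ℕ) (hq : q.Prime) (hqΔ : (q : ℤ) ∣ discOf [a1, a2, a3, a4, a6])
    (hqc₄ : (q : ℤ) ∣ c4Of [a1, a2, a3, a4, a6])
    (hsurj : Surj (⟨a1, a2, a3, a4, a6⟩ : WeierstrassCurve ℚ) p)
    (hr : (⟨a1, a2, a3, a4, a6⟩ : WeierstrassCurve ℚ).analyticRank = 1)
    [NeZero ((⟨a1, a2, a3, a4, a6⟩ : WeierstrassCurve ℚ).conductorNorm ℤ)]
    {f₀ : CuspForm (Gamma0 ((⟨a1, a2, a3, a4, a6⟩ : WeierstrassCurve ℚ).conductorNorm ℤ)) 2}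
    (hf₀ : IsNewformOf (⟨a1, a2, a3, a4, a6⟩ : WeierstrassCurve ℚ) f₀)
    {n : ℕ} (hn : Even n) {Θ : IwasawaAlgebra p}
    (hΘ : iwasawaToPowerSeries p Θ =
      ((mazurTateElement f₀ p n).map (algebraMap ℚ ℚ_[p]) : PowerSeries ℚ_[p]))
    (hΘ0 : Θ ≠ 0) (hμ : mu Θ = 0) (hlam : lam Θ = (cyclotomicOmegaMinus p n).natDegree + 1) :
    BSDp (⟨a1, a2, a3, a4, a6⟩ : WeierstrassCurve ℚ) p := by
  have hI : integralModelInt (⟨a1, a2, a3, a4, a6⟩ : WeierstrassCurve ℚ) = ⟨a1, a2, a3, a4, a6⟩ :=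
    integralModelInt_eq_of_map_eq _ (map_mk_int a1 a2 a3 a4 a6)
  have hn' := natCard_point_eq_of_countPoints a1 a2 a3 a4 a6 p hp2 hpΔ hc
  have hX : ClassX7 (⟨a1, a2, a3, a4, a6⟩ : WeierstrassCurve ℚ) p :=
    classX7_of_intModel p hI (by rw [intCurve_Δ]; exact hpΔ) hn' (by push_cast; simp) q hq
      (by rw [intCurve_Δ]; exact hqΔ) (by rw [intCurve_c₄]; exact hqc₄)
  have hap : (⟨a1, a2, a3, a4, a6⟩ : WeierstrassCurve ℚ).frobeniusTrace p = 0 := by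
    rw [frobeniusTrace_eq hI hn']; push_cast; ring
  exact X7.bsdp_of_mazurTate_even_of_corA5_of_analyticRank_eq_one _ p h12 h41 h5 h3 hL20 hGZK hmod hA5 hp2 hX
    hap hsurj hr hf₀ hn hΘ hΘ0 hμ hlam (lam_lt_of_mazurTate hΘ hΘ0 hμ)

/-! ### Layer one (odd colour, `ε = −1`): the numeric certificate `λ(θ₁) = 1` -/

/-- **RECORD SHAPE, layer one — `KobayashiMainConjecture W p (−1)` AT THE PAIR from `θ₁ ≢ 0 (mod p)`,
`λ(θ₁) = 1`** (`= deg ω₁⁺ + 1`, `RankOne.natDegree_cyclotomicOmegaPlus_one`); otherwise as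
`RankOne.kobayashiMainConjecture_neg_one_of_mazurTate_of_countPoints` (p447529). Flag-free: PUBLISHED inputs by
name + data binders + the certificate. Per pair; nothing booked. [cite: Kobayashi2003, Thm. 1.2, Thm. 4.1 and Conjecture (p. 2)]
[cite: Pollack2003, §6.5, Def. 6.15, Prop. 6.9, 6.10 and 6.18] [cite: Wuthrich2014, Lemma 20 (p. 399)] -/
theorem RankOne.kobayashiMainConjecture_neg_one_of_mazurTate_layerOne_of_countPoints (p : ℕ) [Fact p.Prime]
    (h12 : Kobayashi2003.thm12_signedSelmerDual_finite_torsion)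
    (h41 : Kobayashi2003.thm41_signedCharIdeal_divisibility)
    (h5 : realPeriodRat_eq_unit_mul_plusPeriod) (h3 : realPeriodRat_eq_unit_mul_plusPeriod_three)
    (hL20 : Wuthrich2014.lemma20_surjective_threeAdic_of_semistable)
    (hGZK : rank_eq_analyticRank_of_analyticRank_le_one)
    (a1 a2 a3 a4 a6 : ℤ) [(⟨a1, a2, a3, a4, a6⟩ : WeierstrassCurve ℚ).IsElliptic]
    [(⟨a1, a2, a3, a4, a6⟩ : WeierstrassCurve ℚ).IsGloballyMinimal] (hp2 : p ≠ 2)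
    (hpΔ : ¬ (p : ℤ) ∣ discOf [a1, a2, a3, a4, a6]) (hc : countPoints [a1, a2, a3, a4, a6] p = (p + 1 : ℕ))
    (hsurj : Surj (⟨a1, a2, a3, a4, a6⟩ : WeierstrassCurve ℚ) p)
    (hr : (⟨a1, a2, a3, a4, a6⟩ : WeierstrassCurve ℚ).analyticRank = 1)
    [NeZero ((⟨a1, a2, a3, a4, a6⟩ : WeierstrassCurve ℚ).conductorNorm ℤ)]
    {f₀ : CuspForm (Gamma0 ((⟨a1, a2, a3, a4, a6⟩ : WeierstrassCurve ℚ).conductorNorm ℤ)) 2}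
    (hf₀ : IsNewformOf (⟨a1, a2, a3, a4, a6⟩ : WeierstrassCurve ℚ) f₀)
    {Θ : IwasawaAlgebra p}
    (hΘ : iwasawaToPowerSeries p Θ =
      ((mazurTateElement f₀ p 1).map (algebraMap ℚ ℚ_[p]) : PowerSeries ℚ_[p]))
    (hΘ0 : Θ ≠ 0) (hμ : mu Θ = 0) (hlam : lam Θ = 1) :
    KobayashiMainConjecture (⟨a1, a2, a3, a4, a6⟩ : WeierstrassCurve ℚ) p (-1) :=
  RankOne.kobayashiMainConjecture_neg_one_of_mazurTate_of_countPoints p h12 h41 h5 h3 hL20 hGZK a1 a2 a3 a4 a6 hp2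
    hpΔ hc hsurj hr hf₀ odd_one hΘ hΘ0 hμ (by rw [hlam, RankOne.natDegree_cyclotomicOmegaPlus_one])

/-- **RECORD SHAPE, layer one — the CRUX'S CONCLUSION `∃ ε, KobayashiLowerDivisibility W p ε` AT THE PAIR**
from `θ₁ ≢ 0 (mod p)`, `λ(θ₁) = 1` (witness `ε = −1`). Flag-free. Per pair; the crux itself is untouched.
[cite: Kobayashi2003, Thm. 1.2, Thm. 4.1 and Conjecture (p. 2)] [cite: Pollack2003, §6.5, Def. 6.15, Prop. 6.9, 6.10 and 6.18]
[cite: Wuthrich2014, Lemma 20 (p. 399)] -/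
theorem RankOne.exists_kobayashiLowerDivisibility_of_mazurTate_layerOne_of_countPoints (p : ℕ) [Fact p.Prime]
    (h12 : Kobayashi2003.thm12_signedSelmerDual_finite_torsion)
    (h41 : Kobayashi2003.thm41_signedCharIdeal_divisibility)
    (h5 : realPeriodRat_eq_unit_mul_plusPeriod) (h3 : realPeriodRat_eq_unit_mul_plusPeriod_three)
    (hL20 : Wuthrich2014.lemma20_surjective_threeAdic_of_semistable)
    (hGZK : rank_eq_analyticRank_of_analyticRank_le_one)
    (a1 a2 a3 a4 a6 : ℤ) [(⟨a1, a2, a3, a4, a6⟩ : WeierstrassCurve ℚ).IsElliptic]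
    [(⟨a1, a2, a3, a4, a6⟩ : WeierstrassCurve ℚ).IsGloballyMinimal] (hp2 : p ≠ 2)
    (hpΔ : ¬ (p : ℤ) ∣ discOf [a1, a2, a3, a4, a6]) (hc : countPoints [a1, a2, a3, a4, a6] p = (p + 1 : ℕ))
    (hsurj : Surj (⟨a1, a2, a3, a4, a6⟩ : WeierstrassCurve ℚ) p)
    (hr : (⟨a1, a2, a3, a4, a6⟩ : WeierstrassCurve ℚ).analyticRank = 1)
    [NeZero ((⟨a1, a2, a3, a4, a6⟩ : WeierstrassCurve ℚ).conductorNorm ℤ)]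
    {f₀ : CuspForm (Gamma0 ((⟨a1, a2, a3, a4, a6⟩ : WeierstrassCurve ℚ).conductorNorm ℤ)) 2}
    (hf₀ : IsNewformOf (⟨a1, a2, a3, a4, a6⟩ : WeierstrassCurve ℚ) f₀)
    {Θ : IwasawaAlgebra p}
    (hΘ : iwasawaToPowerSeries p Θ =
      ((mazurTateElement f₀ p 1).map (algebraMap ℚ ℚ_[p]) : PowerSeries ℚ_[p]))
    (hΘ0 : Θ ≠ 0) (hμ : mu Θ = 0) (hlam : lam Θ = 1) :
    ∃ ε : ℤˣ, KobayashiLowerDivisibility (⟨a1, a2, a3, a4, a6⟩ : WeierstrassCurve ℚ) p ε :=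
  ⟨-1, kobayashiLowerDivisibility_of_mainConjecture
    (RankOne.kobayashiMainConjecture_neg_one_of_mazurTate_layerOne_of_countPoints p h12 h41 h5 h3 hL20 hGZK a1 a2
      a3 a4 a6 hp2 hpΔ hc hsurj hr hf₀ hΘ hΘ0 hμ hlam)⟩

/-- **RECORD SHAPE, layer one — class X7, `BSD(E,p)` AT THE PAIR** from `θ₁ ≢ 0 (mod p)`, `λ(θ₁) = 1` and BKO
2024 Cor. A.5 (`hA5`, referee flags displayed in `X7RankOne.bsdp_of_mazurTate_odd_of_corA5_of_countPoints`);
minimality as the instance hypothesis. Per pair; nothing booked. [cite: BurungaleKobayashiOta2023, App. A Cor. A.5]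
[cite: Kobayashi2003, Thm. 7.4, Thm. 1.2, Thm. 4.1 and Conjecture (p. 2)] [cite: Pollack2003, §6.5, Def. 6.15, Prop. 6.9, 6.10 and 6.18]
[cite: Wuthrich2014, Lemma 20 (p. 399)] [cite: SilvermanAEC2009, VII.5 Prop. 5.1(a) and (c)] [cite: Miller2011LMS, §1 and Def. 1.1] -/
theorem X7RankOne.bsdp_of_mazurTate_layerOne_of_corA5_of_countPoints (p : ℕ) [Fact p.Prime]
    (h12 : Kobayashi2003.thm12_signedSelmerDual_finite_torsion)
    (h41 : Kobayashi2003.thm41_signedCharIdeal_divisibility)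
    (h5 : realPeriodRat_eq_unit_mul_plusPeriod) (h3 : realPeriodRat_eq_unit_mul_plusPeriod_three)
    (hL20 : Wuthrich2014.lemma20_surjective_threeAdic_of_semistable)
    (hGZK : rank_eq_analyticRank_of_analyticRank_le_one) (hmod : hasEntireLFunction_rat)
    (hA5 : corA5_pPart_of_signedCharIdeal_eq)
    (a1 a2 a3 a4 a6 : ℤ) [(⟨a1, a2, a3, a4, a6⟩ : WeierstrassCurve ℚ).IsElliptic]
    [(⟨a1, a2, a3, a4, a6⟩ : WeierstrassCurve ℚ).IsGloballyMinimal] (hp2 : p ≠ 2)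
    (hpΔ : ¬ (p : ℤ) ∣ discOf [a1, a2, a3, a4, a6]) (hc : countPoints [a1, a2, a3, a4, a6] p = (p + 1 : ℕ))
    (q : ℕ) (hq : q.Prime) (hqΔ : (q : ℤ) ∣ discOf [a1, a2, a3, a4, a6])
    (hqc₄ : (q : ℤ) ∣ c4Of [a1, a2, a3, a4, a6])
    (hsurj : Surj (⟨a1, a2, a3, a4, a6⟩ : WeierstrassCurve ℚ) p)
    (hr : (⟨a1, a2, a3, a4, a6⟩ : WeierstrassCurve ℚ).analyticRank = 1)
    [NeZero ((⟨a1, a2, a3, a4, a6⟩ : WeierstrassCurve ℚ).conductorNorm ℤ)]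
    {f₀ : CuspForm (Gamma0 ((⟨a1, a2, a3, a4, a6⟩ : WeierstrassCurve ℚ).conductorNorm ℤ)) 2}
    (hf₀ : IsNewformOf (⟨a1, a2, a3, a4, a6⟩ : WeierstrassCurve ℚ) f₀)
    {Θ : IwasawaAlgebra p}
    (hΘ : iwasawaToPowerSeries p Θ =
      ((mazurTateElement f₀ p 1).map (algebraMap ℚ ℚ_[p]) : PowerSeries ℚ_[p]))
    (hΘ0 : Θ ≠ 0) (hμ : mu Θ = 0) (hlam : lam Θ = 1) :
    BSDp (⟨a1, a2, a3, a4, a6⟩ : WeierstrassCurve ℚ) p :=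
  X7RankOne.bsdp_of_mazurTate_odd_of_corA5_of_isGloballyMinimal_of_countPoints p h12 h41 h5 h3 hL20 hGZK hmod hA5
    a1 a2 a3 a4 a6 hp2 hpΔ hc q hq hqΔ hqc₄ hsurj hr hf₀ odd_one hΘ hΘ0 hμ
    (by rw [hlam, RankOne.natDegree_cyclotomicOmegaPlus_one])

/-! ### Layer two (even colour, `ε = 1`): the numeric certificate `λ(θ₂) = p` -/

/-- **RECORD SHAPE, layer two — `KobayashiMainConjecture W p 1` AT THE PAIR from `θ₂ ≢ 0 (mod p)`,
`λ(θ₂) = p`** (`= deg ω₂⁻ + 1`, `RankOne.natDegree_cyclotomicOmegaMinus_two_add_one`); otherwise as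
`RankOne.kobayashiMainConjecture_one_of_mazurTate_of_countPoints` (p447529). Flag-free. Per pair; nothing booked.
[cite: Kobayashi2003, Thm. 1.2, Thm. 4.1 and Conjecture (p. 2)] [cite: Pollack2003, §6.5, Def. 6.15, Prop. 6.9, 6.10 and 6.18]
[cite: Wuthrich2014, Lemma 20 (p. 399)] -/
theorem RankOne.kobayashiMainConjecture_one_of_mazurTate_layerTwo_of_countPoints (p : ℕ) [Fact p.Prime]
    (h12 : Kobayashi2003.thm12_signedSelmerDual_finite_torsion)
    (h41 : Kobayashi2003.thm41_signedCharIdeal_divisibility)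
    (h5 : realPeriodRat_eq_unit_mul_plusPeriod) (h3 : realPeriodRat_eq_unit_mul_plusPeriod_three)
    (hL20 : Wuthrich2014.lemma20_surjective_threeAdic_of_semistable)
    (hGZK : rank_eq_analyticRank_of_analyticRank_le_one)
    (a1 a2 a3 a4 a6 : ℤ) [(⟨a1, a2, a3, a4, a6⟩ : WeierstrassCurve ℚ).IsElliptic]
    [(⟨a1, a2, a3, a4, a6⟩ : WeierstrassCurve ℚ).IsGloballyMinimal] (hp2 : p ≠ 2)
    (hpΔ : ¬ (p : ℤ) ∣ discOf [a1, a2, a3, a4, a6]) (hc : countPoints [a1, a2, a3, a4, a6] p = (p + 1 : ℕ))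
    (hsurj : Surj (⟨a1, a2, a3, a4, a6⟩ : WeierstrassCurve ℚ) p)
    (hr : (⟨a1, a2, a3, a4, a6⟩ : WeierstrassCurve ℚ).analyticRank = 1)
    [NeZero ((⟨a1, a2, a3, a4, a6⟩ : WeierstrassCurve ℚ).conductorNorm ℤ)]
    {f₀ : CuspForm (Gamma0 ((⟨a1, a2, a3, a4, a6⟩ : WeierstrassCurve ℚ).conductorNorm ℤ)) 2}
    (hf₀ : IsNewformOf (⟨a1, a2, a3, a4, a6⟩ : WeierstrassCurve ℚ) f₀)
    {Θ : IwasawaAlgebra p}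
    (hΘ : iwasawaToPowerSeries p Θ =
      ((mazurTateElement f₀ p 2).map (algebraMap ℚ ℚ_[p]) : PowerSeries ℚ_[p]))
    (hΘ0 : Θ ≠ 0) (hμ : mu Θ = 0) (hlam : lam Θ = p) :
    KobayashiMainConjecture (⟨a1, a2, a3, a4, a6⟩ : WeierstrassCurve ℚ) p 1 :=
  RankOne.kobayashiMainConjecture_one_of_mazurTate_of_countPoints p h12 h41 h5 h3 hL20 hGZK a1 a2 a3 a4 a6 hp2
    hpΔ hc hsurj hr hf₀ even_two hΘ hΘ0 hμ (by rw [hlam, RankOne.natDegree_cyclotomicOmegaMinus_two_add_one])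

/-- **RECORD SHAPE, layer two — the CRUX'S CONCLUSION `∃ ε, KobayashiLowerDivisibility W p ε` AT THE PAIR**
from `θ₂ ≢ 0 (mod p)`, `λ(θ₂) = p` (witness `ε = 1`). Flag-free. Per pair; the crux itself is untouched.
[cite: Kobayashi2003, Thm. 1.2, Thm. 4.1 and Conjecture (p. 2)] [cite: Pollack2003, §6.5, Def. 6.15, Prop. 6.9, 6.10 and 6.18]
[cite: Wuthrich2014, Lemma 20 (p. 399)] -/
theorem RankOne.exists_kobayashiLowerDivisibility_of_mazurTate_layerTwo_of_countPoints (p : ℕ) [Fact p.Prime]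
    (h12 : Kobayashi2003.thm12_signedSelmerDual_finite_torsion)
    (h41 : Kobayashi2003.thm41_signedCharIdeal_divisibility)
    (h5 : realPeriodRat_eq_unit_mul_plusPeriod) (h3 : realPeriodRat_eq_unit_mul_plusPeriod_three)
    (hL20 : Wuthrich2014.lemma20_surjective_threeAdic_of_semistable)
    (hGZK : rank_eq_analyticRank_of_analyticRank_le_one)
    (a1 a2 a3 a4 a6 : ℤ) [(⟨a1, a2, a3, a4, a6⟩ : WeierstrassCurve ℚ).IsElliptic]
    [(⟨a1, a2, a3, a4, a6⟩ : WeierstrassCurve ℚ).IsGloballyMinimal] (hp2 : p ≠ 2)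
    (hpΔ : ¬ (p : ℤ) ∣ discOf [a1, a2, a3, a4, a6]) (hc : countPoints [a1, a2, a3, a4, a6] p = (p + 1 : ℕ))
    (hsurj : Surj (⟨a1, a2, a3, a4, a6⟩ : WeierstrassCurve ℚ) p)
    (hr : (⟨a1, a2, a3, a4, a6⟩ : WeierstrassCurve ℚ).analyticRank = 1)
    [NeZero ((⟨a1, a2, a3, a4, a6⟩ : WeierstrassCurve ℚ).conductorNorm ℤ)]
    {f₀ : CuspForm (Gamma0 ((⟨a1, a2, a3, a4, a6⟩ : WeierstrassCurve ℚ).conductorNorm ℤ)) 2}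
    (hf₀ : IsNewformOf (⟨a1, a2, a3, a4, a6⟩ : WeierstrassCurve ℚ) f₀)
    {Θ : IwasawaAlgebra p}
    (hΘ : iwasawaToPowerSeries p Θ =
      ((mazurTateElement f₀ p 2).map (algebraMap ℚ ℚ_[p]) : PowerSeries ℚ_[p]))
    (hΘ0 : Θ ≠ 0) (hμ : mu Θ = 0) (hlam : lam Θ = p) :
    ∃ ε : ℤˣ, KobayashiLowerDivisibility (⟨a1, a2, a3, a4, a6⟩ : WeierstrassCurve ℚ) p ε :=
  ⟨1, kobayashiLowerDivisibility_of_mainConjecture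
    (RankOne.kobayashiMainConjecture_one_of_mazurTate_layerTwo_of_countPoints p h12 h41 h5 h3 hL20 hGZK a1 a2 a3
      a4 a6 hp2 hpΔ hc hsurj hr hf₀ hΘ hΘ0 hμ hlam)⟩

/-- **RECORD SHAPE, layer two — class X7, `BSD(E,p)` AT THE PAIR** from `θ₂ ≢ 0 (mod p)`, `λ(θ₂) = p` and BKO
2024 Cor. A.5 (`hA5`, referee flags displayed in `X7RankOne.bsdp_of_mazurTate_even_of_corA5_of_countPoints`);
minimality as the instance hypothesis. Per pair; nothing booked. [cite: BurungaleKobayashiOta2023, App. A Cor. A.5]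
[cite: Kobayashi2003, Thm. 7.4, Thm. 1.2, Thm. 4.1 and Conjecture (p. 2)] [cite: Pollack2003, §6.5, Def. 6.15, Prop. 6.9, 6.10 and 6.18]
[cite: Wuthrich2014, Lemma 20 (p. 399)] [cite: SilvermanAEC2009, VII.5 Prop. 5.1(a) and (c)] [cite: Miller2011LMS, §1 and Def. 1.1] -/
theorem X7RankOne.bsdp_of_mazurTate_layerTwo_of_corA5_of_countPoints (p : ℕ) [Fact p.Prime]
    (h12 : Kobayashi2003.thm12_signedSelmerDual_finite_torsion)
    (h41 : Kobayashi2003.thm41_signedCharIdeal_divisibility)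
    (h5 : realPeriodRat_eq_unit_mul_plusPeriod) (h3 : realPeriodRat_eq_unit_mul_plusPeriod_three)
    (hL20 : Wuthrich2014.lemma20_surjective_threeAdic_of_semistable)
    (hGZK : rank_eq_analyticRank_of_analyticRank_le_one) (hmod : hasEntireLFunction_rat)
    (hA5 : corA5_pPart_of_signedCharIdeal_eq)
    (a1 a2 a3 a4 a6 : ℤ) [(⟨a1, a2, a3, a4, a6⟩ : WeierstrassCurve ℚ).IsElliptic]
    [(⟨a1, a2, a3, a4, a6⟩ : WeierstrassCurve ℚ).IsGloballyMinimal] (hp2 : p ≠ 2)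
    (hpΔ : ¬ (p : ℤ) ∣ discOf [a1, a2, a3, a4, a6]) (hc : countPoints [a1, a2, a3, a4, a6] p = (p + 1 : ℕ))
    (q : ℕ) (hq : q.Prime) (hqΔ : (q : ℤ) ∣ discOf [a1, a2, a3, a4, a6])
    (hqc₄ : (q : ℤ) ∣ c4Of [a1, a2, a3, a4, a6])
    (hsurj : Surj (⟨a1, a2, a3, a4, a6⟩ : WeierstrassCurve ℚ) p)
    (hr : (⟨a1, a2, a3, a4, a6⟩ : WeierstrassCurve ℚ).analyticRank = 1)
    [NeZero ((⟨a1, a2, a3, a4, a6⟩ : WeierstrassCurve ℚ).conductorNorm ℤ)]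
    {f₀ : CuspForm (Gamma0 ((⟨a1, a2, a3, a4, a6⟩ : WeierstrassCurve ℚ).conductorNorm ℤ)) 2}
    (hf₀ : IsNewformOf (⟨a1, a2, a3, a4, a6⟩ : WeierstrassCurve ℚ) f₀)
    {Θ : IwasawaAlgebra p}
    (hΘ : iwasawaToPowerSeries p Θ =
      ((mazurTateElement f₀ p 2).map (algebraMap ℚ ℚ_[p]) : PowerSeries ℚ_[p]))
    (hΘ0 : Θ ≠ 0) (hμ : mu Θ = 0) (hlam : lam Θ = p) :
    BSDp (⟨a1, a2, a3, a4, a6⟩ : WeierstrassCurve ℚ) p :=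
  X7RankOne.bsdp_of_mazurTate_even_of_corA5_of_isGloballyMinimal_of_countPoints p h12 h41 h5 h3 hL20 hGZK hmod hA5
    a1 a2 a3 a4 a6 hp2 hpΔ hc q hq hqΔ hqc₄ hsurj hr hf₀ even_two hΘ hΘ0 hμ
    (by rw [hlam, RankOne.natDegree_cyclotomicOmegaMinus_two_add_one])

end Summit.BirchSwinnertonDyer.BirchSwinnertonDyer.Theorems

end
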